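import Summits.KontsevichZagierPeriods.KontsevichZagierPeriods.Theses.SpectrahedralScissors
import Literature.NumberTheory.Transcendental.KZVolumeConjectureProofs

/-!
# Crux `SeparabilityKernel` (stmt-KontsevichZagierPeriods-9263) — birth skeleton (`Lines/birth.lean`, BC3)

Route `SpectrahedralScissors`, rank-0 TARGET crux `SeparabilityKernel` (auto-crux since the
2026-08-16 backfill): the KERNEL FORM OF THE ENLARGED CALCULUS `KZ^sep` —
`ker KZ.eval ⊆ closure (four move sets ∪ S_ℝ ∪ S_ℂ)`, `S_ℝ`, `S_ℂ` the two separability relators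
(`[P_ℝ, 64] − [D_ℝ, 29]` in dimension 9, `[P_ℂ, 33] − [D_ℂ, 8]` in dimension 15, literal bodies of
the route decl). Honest status recorded in the route: GPC-strength (`⟸ KZKernelConjecture` by
monotonicity of `closure`; `∧` the instances `⟹` the Statement, `closes`).

This file names the enlarged subgroup `kzSep` (definitionally the closure written in the crux:
`separabilityKernel_iff` is `Iff.rfl`) and cuts the crux along the SPECTRAHEDRAL SECTOR of the
calculus — the sector the route lives in (its two relators are volume identities between compact
rational spectrahedra `{x | A₀ + Σ xᵢ Aᵢ ≽ 0}`: `D = {ρ ≽ 0}`, `P = D ∩ D^Γ`):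

* `stub_spectrahedralHilbertThree` (conjecture-grade, a CONSEQUENCE of Conjecture 1; "the route's
  mechanism run on every pair"): HILBERT'S THIRD PROBLEM FOR RATIONAL SPECTRAHEDRA INSIDE `KZ^sep` —
  every difference `[S₁, q₁] − [S₂, q₂]` of two compact rational spectrahedra with rational constant
  weights and EQUAL VALUE (`q₁ vol S₁ = q₂ vol S₂`) lies in `kzSep`. The set of these differences is
  `spectrahedralPairs`; it contains (provably, not syntactically: block-diagonal pencils, realified
  Hermitian pencils, the landed value theorems `LovasAndai2017_…_holds` / `HuongKhoi2024_…_holds`)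
  the two separability relators, the polytope pairs (diagonal pencils; known sector, cf.
  ScissorsTransport.PolytopeTransport), ball/cylinder pairs (Archimedes), elliptope pairs
  (`64·vol E₃ = 27·vol E₄` for the bodies of `3×3` / `4×4` correlation matrices, `vol E₃ = π²/2`,
  `vol E₄ = 32π²/27` by the partial-correlation change of variables; registrar MC check
  0.6162 ± 0.0009 vs 0.6169, 0.1827 ± 0.0016 vs 0.1828) … — the natural test-bed "all
  rational-ratio volume coincidences among rational spectrahedra are cut-and-paste".
* `stub_volumeFormModSpectrahedra` (conjecture-grade, GPC-strength RELATIVE to the spectrahedral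
  sector): CURVED HILBERT III MODULO SPECTRAHEDRAL COINCIDENCES — two compact top-dimensional
  integrand-`1` representations of one dimension with equal volume differ by an element of
  `KZ.relations ⊔ closure spectrahedralPairs`. (With `closure spectrahedralPairs` deleted this is the
  printed volume form of Conjecture 1, `KZ.volumeConjectureCompact` [CressonViusos2022 §1 p. 326],
  landed-equivalent to the summit — so it is NOT filed in that form.)

Composition `SeparabilityKernel_of_stubs : S1 → S2 → SeparabilityKernel` is a real proof over the
LANDED Cresson–Viu-Sos seam (every formal combination is, modulo moves, a difference of two compact
top-dimensional volume representations of one dimension: `KZ.exists_integralRep_sub_holds`,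
`KZ.IntegralRep.exists_sub_volumeRep_mem_relations_of_semiCanonicalReduction` applied to the
discharge `KZ.semiCanonicalReduction_holds` of [ViuSos2021 Thm 1.1], `exists_volumeRep_equivalent_of_le`,
`exists_volumeRep_of_add_sub_of_mem_relations`, soundness `KZ.eval_eq_zero_of_mem_relations` /
`KZ.Equivalent.value_eq_holds`): `eval c = 0 ↦ c ≡ [M₁] − [M₂]` with `vol M₁ = vol M₂ ↦` (S2)
`[M₁] − [M₂] ∈ relations ⊔ closure T ↦` (S1 + `relations ≤ kzSep`) `∈ kzSep ↦ c ∈ kzSep`.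
`SeparabilityKernel_of : SeparabilityKernel` feeds the two stubs in BY NAME.

Sandwich (logical position): summit ⟹ S1 and summit ⟹ S2 (both are necessary conditions of
Conjecture 1: a refutation of either refutes the SUMMIT, consistent with the route's kill criteria);
S1 ∧ S2 ⟹ crux (this file); crux ⟹ S2 is provable but not cheap (it needs `S_ℝ ∪ S_ℂ ⊆ closure T`,
i.e. the two separability pairs typed as spectrahedral pairs). Neither stub alone is cheaply the crux
or the summit (BC3 probes in the registrar's folder `bc/probe_*.lean`, defs copied verbatim, no stub
in scope — see `Lines/birth.md`).

Disproof used: none on record (`ledger crux ls stmt-KontsevichZagierPeriods-9263`: no workfiles — no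
Disproof.lean, no Lines, no dead lines; negatives index of the summit consulted). Degenerate data:
`c = 0 ↦` reduction gives `M₁, M₂` two points-raised-to-slabs of equal volume, S2 applies;
empty / lower-dimensional spectrahedra have value `0` on both sides of a pair and are harmless members
of `spectrahedralPairs`; `k = 0` pencils give the one-point body in dimension `0` only (compactness).
-/

noncomputable section

set_option linter.dupNamespace false

namespace Summit.KontsevichZagierPeriods.KontsevichZagierPeriods.Cruxes.SeparabilityKernel.Birth

open scoped BigOperators Matrix ComplexOrder
open Set MeasureTheory
open Literature.NumberTheory.Transcendental Literature.NumberTheory.Transcendental.KZ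

/-! ### The vocabulary of the crux, named (literal bodies copied from the route decl) -/

/-- **The rebit separability relators `S_ℝ`** (dimension 9): differences `[P_ℝ, 64] − [D_ℝ, 29]`,
`D_ℝ = {ρ(y) ≽ 0}` the two-rebit states in the route's affine chart, `P_ℝ = D_ℝ ∩ {ρ(y)^Γ ≽ 0}` its
PPT sub-body — VERBATIM the first relator set of `Theses.SpectrahedralScissors.SeparabilityKernel`
(= the first conjunct of `Transport`'s conclusion). Value equality `64 vol P_ℝ = 29 vol D_ℝ` is
Lovas–Andai's theorem, landed (`LovasAndai2017_rebit_separability_probability_holds`).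
[cite: LovasAndai2017, Thm 2] -/
def rebitRelators : Set KZ.FormalRep :=
  {c | ∃ (ρ ρ' : (Fin 9 → ℝ) → Matrix (Fin 4) (Fin 4) ℝ) (r r' : Literature.NumberTheory.Transcendental.KZ.IntegralRep 9), (∀ y, ρ y = !![y 0, y 2, y 5, y 6; y 2, y 1, y 7, y 8; y 5, y 7, y 3, y 4; y 6, y 8, y 4, 1 - y 0 - y 1 - y 3]) ∧ (∀ y, ρ' y = !![y 0, y 2, y 5, y 7; y 2, y 1, y 6, y 8; y 5, y 6, y 3, y 4; y 7, y 8, y 4, 1 - y 0 - y 1 - y 3]) ∧ r.domain = {y | (ρ y).PosSemidef ∧ (ρ' y).PosSemidef} ∧ Set.EqOn r.integrand (fun _ => 64) r.domain ∧ r'.domain = {y | (ρ y).PosSemidef} ∧ Set.EqOn r'.integrand (fun _ => 29) r'.domain ∧ c = Literature.NumberTheory.Transcendental.KZ.of r - Literature.NumberTheory.Transcendental.KZ.of r'}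

/-- **The qubit separability relators `S_ℂ`** (dimension 15): differences `[P_ℂ, 33] − [D_ℂ, 8]`,
`D_ℂ = {ρ(y) ≽ 0}` the two-qubit states, `P_ℂ` the PPT (= separable, Peres–Horodecki) sub-body —
VERBATIM the second relator set of the crux. Value equality `33 vol P_ℂ = 8 vol D_ℂ` is Huong–Khoi's
theorem (Slater's `8/33`), landed (`HuongKhoi2024_qubit_separability_probability_holds`).
[cite: HuongKhoi2024] [cite: ZhangJiangXie2025, Prop 6.10] -/
def qubitRelators : Set KZ.FormalRep :=
  {c | ∃ (ρ ρ' : (Fin 15 → ℝ) → Matrix (Fin 4) (Fin 4) ℂ) (r r' : Literature.NumberTheory.Transcendental.KZ.IntegralRep 15), (∀ y, ρ y = !![((y 0 : ℝ) : ℂ), (⟨y 2, y 3⟩ : ℂ), (⟨y 7, y 8⟩ : ℂ), (⟨y 9, y 10⟩ : ℂ); (⟨y 2, -y 3⟩ : ℂ), ((y 1 : ℝ) : ℂ), (⟨y 11, y 12⟩ : ℂ), (⟨y 13, y 14⟩ : ℂ); (⟨y 7, -y 8⟩ : ℂ), (⟨y 11, -y 12⟩ : ℂ), ((y 4 : ℝ)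 : ℂ), (⟨y 5, y 6⟩ : ℂ); (⟨y 9, -y 10⟩ : ℂ), (⟨y 13, -y 14⟩ : ℂ), (⟨y 5, -y 6⟩ : ℂ), ((1 - y 0 - y 1 - y 4 : ℝ) : ℂ)]) ∧ (∀ y, ρ' y = !![((y 0 : ℝ) : ℂ), (⟨y 2, y 3⟩ : ℂ), (⟨y 7, -y 8⟩ : ℂ), (⟨y 11, -y 12⟩ : ℂ); (⟨y 2, -y 3⟩ : ℂ), ((y 1 : ℝ) : ℂ), (⟨y 9, -y 10⟩ : ℂ), (⟨y 13, -y 14⟩ : ℂ); (⟨y 7, y 8⟩ : ℂ), (⟨y 9, y 10⟩ : ℂ), ((y 4 : ℝ) : ℂ), (⟨y 5, y 6⟩ : ℂ); (⟨y 11, y 12⟩ : ℂ), (⟨y 13, y 14⟩ : ℂ), (⟨y 5, -y 6⟩ : ℂ), ((1 - y 0 - y 1 - y 4 : ℝ) : ℂ)]) ∧ r.domain = {y | (ρ y).PosSemidef ∧ (ρ' y).PosSemidef} ∧ Set.EqOn r.integrand (fun _ => 33) r.domain ∧ r'.domain = {y | (ρ y).PosSemidef} ∧ Set.EqOn r'.integrand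 (fun _ => 8) r'.domain ∧ c = Literature.NumberTheory.Transcendental.KZ.of r - Literature.NumberTheory.Transcendental.KZ.of r'}

/-- **The relation subgroup of the enlarged calculus `KZ^sep`**: the four move sets of the
Kontsevich–Zagier calculus together with the two separability relators. Definitionally the closure
written in the crux (`separabilityKernel_iff`). [cite: KontsevichZagier2001, §1.2] -/
def kzSep : AddSubgroup KZ.FormalRep :=
  AddSubgroup.closure (KZ.domainAddRel ∪ KZ.integrandAddRel ∪ KZ.changeOfVariablesRel ∪
    KZ.newtonLeibnizRel ∪ (rebitRelators ∪ qubitRelators))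

/-- The crux is the kernel statement `ker eval ⊆ kzSep` — by `Iff.rfl` (the bodies agree literally).
[cite: KontsevichZagier2001, §1.2 Conjecture 1] -/
theorem separabilityKernel_iff :
    Summit.KontsevichZagierPeriods.KontsevichZagierPeriods.Theses.SpectrahedralScissors.SeparabilityKernel ↔
      ∀ c : KZ.FormalRep, KZ.eval c = 0 → c ∈ kzSep :=
  Iff.rfl

/-- The plain relations are relations of the enlarged calculus. [cite: KontsevichZagier2001, §1.2] -/
theorem relations_le_kzSep : KZ.relations ≤ kzSep := by
  refine (AddSubgroup.closure_le _).mpr ?_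
  rintro c hc
  exact AddSubgroup.subset_closure (Or.inl hc)

/-- **The spectrahedral sector: equal-value pairs of weighted compact rational spectrahedra.**
`spectrahedralPairs` is the set of differences `[r] − [r']` where `r` (dimension `n`) has domain the
spectrahedron `{x | A 0 + Σᵢ xᵢ • A (i+1) ≽ 0}` of a pencil of real `k × k` matrices with RATIONAL
entries, compact, with a rational constant integrand `q` on it; `r'` likewise (dimension `m`, size
`l`, weight `q'`); and the two VALUES agree (`q · vol = q' · vol'`). (`Matrix.PosSemidef` includes
symmetry, so non-symmetric pencils only shrink the set; complex Hermitian LMIs enter through their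
realification.) Every member evaluates to `0`; Conjecture 1 predicts each is a relation.
[cite: CressonViusos2022, §1 Conjecture 1.1 (GKZ: volume is the only invariant)]
[cite: LovasAndai2017, Thm 2] [cite: HuongKhoi2024] -/
def spectrahedralPairs : Set KZ.FormalRep :=
  {c | ∃ (n m k l : ℕ) (A : Fin (n + 1) → Matrix (Fin k) (Fin k) ℝ)
      (B : Fin (m + 1) → Matrix (Fin l) (Fin l) ℝ) (q q' : ℚ)
      (r : KZ.IntegralRep n) (r' : KZ.IntegralRep m),
    (∀ i a b, ∃ t : ℚ, A i a b = (t : ℝ)) ∧ (∀ i a b, ∃ t : ℚ, B i a b = (t : ℝ)) ∧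
    r.domain = {x | (A 0 + ∑ i : Fin n, x i • A i.succ).PosSemidef} ∧ IsCompact r.domain ∧
    Set.EqOn r.integrand (fun _ => (q : ℝ)) r.domain ∧
    r'.domain = {x | (B 0 + ∑ i : Fin m, x i • B i.succ).PosSemidef} ∧ IsCompact r'.domain ∧
    Set.EqOn r'.integrand (fun _ => (q' : ℝ)) r'.domain ∧
    r.value = r'.value ∧ c = KZ.of r - KZ.of r'}

/-! ### Registered stubs (the only `sorry`s of this file) -/

/-- **STUB S1 (conjecture-grade; a consequence of Conjecture 1) — Hilbert's third problem for
rational spectrahedra inside `KZ^sep`.** Every equal-value pair of rationally weighted compact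
rational spectrahedra is a chain of the enlarged calculus: `spectrahedralPairs ⊆ kzSep`. The route's
two instances (29/64, 8/33) are members and are free in `kzSep`; every other member is a genuine
cut-and-paste problem between convex semialgebraic bodies (polytope pairs: known sector; Archimedean
ball/cylinder pairs: radial algebraic change of variables; elliptope pairs `64 vol E₃ = 27 vol E₄`:
partial-correlation change of variables + Beta chains; further separability / moment-body
coincidences). Why it might fail: a rational-ratio volume coincidence between rational spectrahedra
with no move chain even given the two separability axioms — which would refute Conjecture 1 itself.
Size: XL / conjecture-grade (a FAMILY of instances of the route's own kind).
[cite: CressonViusos2022, §1 Conj. 1.1] [cite: LovasAndai2017, Thm 2] [cite: HuongKhoi2024]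
[cite: KontsevichZagier2001, §1.2 Conjecture 1] -/
theorem stub_spectrahedralHilbertThree : spectrahedralPairs ⊆ (kzSep : Set KZ.FormalRep) := by
  sorry

/-- **STUB S2 (conjecture-grade; GPC-strength relative to the spectrahedral sector) — curved
Hilbert III modulo spectrahedral coincidences.** Two integrand-`1` representations of one
dimension on compact domains with non-empty interior and equal volume differ by an element of
`KZ.relations ⊔ closure spectrahedralPairs`: every failure of the printed volume form of
Conjecture 1 [CressonViusos2022 §1 p. 326, `KZ.volumeConjectureCompact`] is generated by
rational-ratio volume coincidences among rational spectrahedra. A consequence of Conjecture 1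
(which gives `∈ KZ.relations` outright). Why it might fail: iff some equal-volume pair of compact
`ℚ`-semialgebraic bodies is connected by no chain even after all spectrahedral coincidences are
adjoined (e.g. a coincidence of genuinely non-convex / higher-weight origin: regularised MZV
relations, Gauss-multiplication pairs — route Neg's candidates — read as volumes by the
semi-canonical reduction). Size: conjecture-grade (GPC-strength off the spectrahedral sector).
[cite: CressonViusos2022, §1 p. 326 Conjecture] [cite: ViuSos2021, Thm 1.1]
[cite: KontsevichZagier2001, §1.2 Conjecture 1] -/
theorem stub_volumeFormModSpectrahedra :
    ∀ ⦃D : ℕ⦄ (A B : KZ.IntegralRep D),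
      IsCompact A.domain → (interior A.domain).Nonempty →
      IsCompact B.domain → (interior B.domain).Nonempty →
      (∀ x ∈ A.domain, A.integrand x = 1) → (∀ x ∈ B.domain, B.integrand x = 1) →
      A.value = B.value →
      KZ.of A - KZ.of B ∈ KZ.relations ⊔ AddSubgroup.closure spectrahedralPairs := by
  sorry

/-! ### Composition (no `sorry` below this line) -/

/-- **The landed seam — every vanishing formal combination is a curved equidecomposability
problem.** For `c` with `KZ.eval c = 0` there are two representations `M₁`, `M₂` of ONE dimension,
with compact domains of non-empty interior, integrand `1` and EQUAL volume, such that
`c − ([M₁] − [M₂]) ∈ KZ.relations`. Proof = the tree's proof of [CressonViusos2022 §1 p. 326]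
(`KZ.kzPeriodConjecture'_of_volumeConjectureCompact`) run on a formal combination: bookkeeping
`KZ.exists_integralRep_sub_holds` (`c ≡ [r] − [r']`), Viu-Sos' semi-canonical reduction discharged
in tree (`KZ.semiCanonicalReduction_holds`, through
`IntegralRep.exists_sub_volumeRep_mem_relations_of_semiCanonicalReduction`), dimension raising by
unit slabs, gluing at disjoint levels, and soundness of the moves for the volume equality.
[cite: CressonViusos2022, §1 p. 326] [cite: ViuSos2021, Thm 1.1] [cite: KontsevichZagier2001, §1.2] -/
theorem exists_sub_volumePair_mem_relations (c : KZ.FormalRep) (hc : KZ.eval c = 0) :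
    ∃ (N : ℕ) (M₁ M₂ : KZ.IntegralRep N),
      IsCompact M₁.domain ∧ (interior M₁.domain).Nonempty ∧
      IsCompact M₂.domain ∧ (interior M₂.domain).Nonempty ∧
      (∀ x ∈ M₁.domain, M₁.integrand x = 1) ∧ (∀ x ∈ M₂.domain, M₂.integrand x = 1) ∧
      M₁.value = M₂.value ∧ c - (KZ.of M₁ - KZ.of M₂) ∈ KZ.relations := by
  obtain ⟨n, m, r, r', hcr⟩ := KZ.exists_integralRep_sub_holds c
  obtain ⟨D, A, B, ⟨hAc, hAi, hA1⟩, ⟨hBc, hBi, hB1⟩, hrAB⟩ :=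
    IntegralRep.exists_sub_volumeRep_mem_relations_of_semiCanonicalReduction
      semiCanonicalReduction_holds r
  obtain ⟨D', A', B', ⟨hA'c, hA'i, hA'1⟩, ⟨hB'c, hB'i, hB'1⟩, hr'AB⟩ :=
    IntegralRep.exists_sub_volumeRep_mem_relations_of_semiCanonicalReduction
      semiCanonicalReduction_holds r'
  -- raise the four volume representations to the common dimension `max D D'`
  obtain ⟨A₁, hA₁c, hA₁i, hA₁1, hAA₁⟩ :=
    A.exists_volumeRep_equivalent_of_le hAc hAi hA1 (le_max_left D D')
  obtain ⟨B₁, hB₁c, hB₁i, hB₁1, hBB₁⟩ :=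
    B.exists_volumeRep_equivalent_of_le hBc hBi hB1 (le_max_left D D')
  obtain ⟨A₁', hA₁'c, hA₁'i, hA₁'1, hAA₁'⟩ :=
    A'.exists_volumeRep_equivalent_of_le hA'c hA'i hA'1 (le_max_right D D')
  obtain ⟨B₁', hB₁'c, hB₁'i, hB₁'1, hBB₁'⟩ :=
    B'.exists_volumeRep_equivalent_of_le hB'c hB'i hB'1 (le_max_right D D')
  -- glue `A₁ ⊔ B₁'` and `A₁' ⊔ B₁`
  obtain ⟨M₁, hM₁c, hM₁i, hM₁1, hM₁⟩ :=
    A₁.exists_volumeRep_of_add_sub_of_mem_relations B₁' hA₁c hA₁i hA₁1 hB₁'c hB₁'1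
  obtain ⟨M₂, hM₂c, hM₂i, hM₂1, hM₂⟩ :=
    A₁'.exists_volumeRep_of_add_sub_of_mem_relations B₁ hA₁'c hA₁'i hA₁'1 hB₁c hB₁1
  -- the two glued sets have the same volume (soundness of the moves and `eval c = 0`)
  have hvol : M₁.value = M₂.value := by
    have e₀ := eval_eq_zero_of_mem_relations hcr
    have e₁ := eval_eq_zero_of_mem_relations hrAB
    have e₂ := eval_eq_zero_of_mem_relations hr'AB
    have e₃ := eval_eq_zero_of_mem_relations hM₁
    have e₄ := eval_eq_zero_of_mem_relations hM₂
    simp only [map_sub, map_add, eval_of, hc] at e₀ e₁ e₂ e₃ e₄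
    have f₁ := Equivalent.value_eq_holds hAA₁
    have f₂ := Equivalent.value_eq_holds hBB₁
    have f₃ := Equivalent.value_eq_holds hAA₁'
    have f₄ := Equivalent.value_eq_holds hBB₁'
    linarith
  refine ⟨max D D' + 1, M₁, M₂, hM₁c, hM₁i, hM₂c, hM₂i, hM₁1, hM₂1, hvol, ?_⟩
  -- bookkeeping in the formal group
  have : c - (of M₁ - of M₂) = (c - (of r - of r'))
      + (of r - (of A - of B)) - (of r' - (of A' - of B'))
      + (of A - of A₁) - (of B - of B₁) - (of A' - of A₁') + (of B' - of B₁')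
      + (of A₁ + of B₁' - of M₁) - (of A₁' + of B₁ - of M₂) := by
    abel
  rw [this]
  exact relations.sub_mem (relations.add_mem (relations.add_mem (relations.sub_mem
    (relations.sub_mem (relations.add_mem (relations.sub_mem (relations.add_mem hcr hrAB) hr'AB)
      hAA₁) hBB₁) hAA₁') hBB₁') hM₁) hM₂

/-- **Decomposition theorem (real proof; hypotheses = the two stub statements).** From S1 the
enlarged subgroup `kzSep` contains `KZ.relations ⊔ closure spectrahedralPairs`; from the landed seam
every `c ∈ ker eval` is `≡ [M₁] − [M₂]` (equal-volume compact bodies) modulo `KZ.relations`; S2 puts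
`[M₁] − [M₂]` in `KZ.relations ⊔ closure spectrahedralPairs`; add. -/
theorem SeparabilityKernel_of_stubs
    (h₁ : spectrahedralPairs ⊆ (kzSep : Set KZ.FormalRep))
    (h₂ : ∀ ⦃D : ℕ⦄ (A B : KZ.IntegralRep D),
      IsCompact A.domain → (interior A.domain).Nonempty →
      IsCompact B.domain → (interior B.domain).Nonempty →
      (∀ x ∈ A.domain, A.integrand x = 1) → (∀ x ∈ B.domain, B.integrand x = 1) →
      A.value = B.value →
      KZ.of A - KZ.of B ∈ KZ.relations ⊔ AddSubgroup.closure spectrahedralPairs) :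
    Summit.KontsevichZagierPeriods.KontsevichZagierPeriods.Theses.SpectrahedralScissors.SeparabilityKernel := by
  rw [separabilityKernel_iff]
  intro c hc
  -- the spectrahedral enlargement sits inside `KZ^sep`
  have hle : KZ.relations ⊔ AddSubgroup.closure spectrahedralPairs ≤ kzSep :=
    sup_le relations_le_kzSep ((AddSubgroup.closure_le _).mpr h₁)
  -- reduce `c` to an equal-volume pair of compact bodies, modulo moves
  obtain ⟨N, M₁, M₂, hM₁c, hM₁i, hM₂c, hM₂i, hM₁1, hM₂1, hvol, hcM⟩ :=
    exists_sub_volumePair_mem_relations c hc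
  -- curved Hilbert III modulo spectrahedral coincidences
  have hM : KZ.of M₁ - KZ.of M₂ ∈ kzSep := hle (h₂ M₁ M₂ hM₁c hM₁i hM₂c hM₂i hM₁1 hM₂1 hvol)
  have hc' : c - (KZ.of M₁ - KZ.of M₂) ∈ kzSep := relations_le_kzSep hcM
  simpa using kzSep.add_mem hc' hM

/-- **The crux BY NAME from the two registered stubs** (the skeleton theorem audited by
`ledger skeleton check`; its only `sorryAx` dependencies are `stub_spectrahedralHilbertThree` and
`stub_volumeFormModSpectrahedra`). -/
theorem SeparabilityKernel_of :
    Summit.KontsevichZagierPeriods.KontsevichZagierPeriods.Theses.SpectrahedralScissors.SeparabilityKernel :=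
  SeparabilityKernel_of_stubs stub_spectrahedralHilbertThree stub_volumeFormModSpectrahedra

end Summit.KontsevichZagierPeriods.KontsevichZagierPeriods.Cruxes.SeparabilityKernel.Birth
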